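import Summits.Ventures.LatticeQCDFlow.Scaling.StarSlowSwapLaw
import Summits.Ventures.LatticeQCDFlow.Scaling.FlowHubProposalLaw
import Summits.Ventures.LatticeQCDFlow.Scaling.FlowLadderEquivariantMixingFloor

/-!
HONEST FRAMING: exact (Metropolis-corrected) sampling algorithms for lattice gauge theory; figures
of merit are autocorrelation/cost numbers at stated couplings and volumes; no continuum-physics
claim.

# FlowStarSlowSwapLaw — THE PERSISTENT FLOW HUB WITH ANY FLOW ON ANY FINITE CONFIGURATION SPACE, `K` COLD REPLICAS, SLOW SWAPS:
# `d(n) ≤ (eK/(p·W_lo) + 1)·e^{−hρn/4}` AND `t_mix(ε) ≤ ⌈(12K(t+h)/(p·h·t))·log((eK/(p·W_lo)+1)/ε)⌉₊`, `ρ = (t/(t+h))(p/3)/K`, WITH `W = (μ_1∘φ)/μ_0` THE FLOW'S IMPORTANCE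
# RATIO, `p = 1/max W` ITS ONE-SIDED DOMINATION CONSTANT AND `W_lo` ITS SECOND-SMALLEST VALUE (lean-2 GEN-34, ours)

Venture-side (OURS).  Cell `lqcd-flow` (pub-lqcd), unit `pub-lqcd-lean-2-g34`, 2026-08-29.  Chapter U, file 8.  THE MODEL: a finite configuration space `S`; a hot law `μ_0` and `K`
cold levels (laws `μ_{k+1}`, all positive); a flow given by level bijections `φ_k : S ≃ S` with a COMMON pulled-back cold law `ν = μ_{k+1}∘φ_k` (e.g. `K` replicas of one target
`μ_1` behind one trained map `φ`); hub list `(0, κ_r+1)` carrying the map `φ_{κ_r}`, uniform (`c` entries per level); exact hot redraws (weight `w_0 > 0`), IDLE cold levels (the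
replicas move only by swaps: this is the swap-and-redraw SKELETON of flow-assisted tempering — within-replica samplers are NOT covered here; for sector-confined samplers see
`SectorExactSlowSwapLaw`), `0 < t < 1`.  By chapter K's conjugacy (`flowHubList_apply_eq_conj`, `tensorFun_starRelabel`, `worstTvDist_relabel`: relabel level `k+1` by `φ_k⁻¹`) this scheme IS the
identity-map homogeneous `q`-content star of `StarSlowSwapLaw` with `q = |S|`, hot law `μ_0`, cold law `ν`; its persistence weight is the flow's IMPORTANCE RATIO `W = ν/μ_0`, hub
domination `p·ν ≤ μ_0` is chapter M's one-sided transported domination, and `W_lo` is any lower bound for `max{W(u),W(v)}`, `u ≠ v`.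

* **`flowStar_worstTvDist_le_slowSwap`** — `4t ≤ h` ⇒ `d(n) ≤ (e·(K·(1/(p·W_lo))) + 1)·exp(−((1−t)w_0·ρ/4)·n)`;
* **`flowStar_mixingTime_le_slowSwap`** — `t_mix(ε) ≤ ⌈(4/((1−t)w_0·ρ))·log((e·(K·(1/(p·W_lo)))+1)/ε)⌉₊`: `O((K/(p·t))·(log K + log(1/(p·W_lo)) + log(1/ε)))`.

Reading (no numerics implied): for the swap-and-redraw skeleton of flow-assisted tempering with `K` cold replicas and one trained map, the worst-start mixing time at slow swaps is
free of any regime linking `t` to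
`p` (chapter M needed `4t ≤ p·h`) and of `|S|`, `π̃_min`; the configuration space enters ONLY through `log(W_max/W_lo)`, the logarithm of the range of the flow's importance ratios
(for a flow with two-sided bounded ratios this is `O(1)` and the law is the conjectured `(K/(p·t))·log(K/ε)`; for a realistic flow it is extensive — the honest price of the
environment-free potential on a general state space, cf. chapter Q's sector route, which pays `log(1/W_lo)` only over sector weights).  NOT CLAIMED: fast swaps; level-dependent
pulled-back laws; moving cold replicas; anything measured.  Literature grade (cell rule): OWN COMPOSITION on U3 and chapter K's conjugacy; nothing cited as a fact; no new bib keys.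
-/

noncomputable section
open Finset Function
open Literature.Probability.MarkovChains

namespace Summit.Ventures.LatticeQCDFlow.Scaling

section Flow
variable {K m : ℕ} {S : Type*} [Fintype S] [DecidableEq S] {μ : Fin (K + 1) → S → ℝ}
variable (κ : Fin m → Fin K) (φ : Fin K → Equiv.Perm S)
variable {M : Fin (K + 1) → S → S → ℝ} {w : Fin (K + 1) → ℝ} {t : ℝ}

/-- **THE FLOW HUB'S DISTANCE PROFILE AT SLOW SWAPS** (`4t ≤ (1−t)w_0`, common pulled-back cold law `ν`, `p·ν ≤ μ_0`, `W_lo ≤ max{ν(u)/μ_0(u), ν(v)/μ_0(v)}` for `u ≠ v`):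
**`d(n) ≤ (e·(K·(1/(p·W_lo))) + 1)·exp(−((1−t)w_0·((t/(t+(1−t)w_0))(p/3)/K)/4)·n)`**. [ours] -/
theorem flowStar_worstTvDist_le_slowSwap [Nonempty S] (hm : 1 ≤ m) (ht0 : 0 < t) (ht1 : t < 1) (hw0 : ∀ k, 0 ≤ w k) (hw00 : 0 < w 0)
    (hw1 : ∑ k, w k = 1) (hμ : ∀ k x, 0 < μ k x) (hμ1 : ∀ k, ∑ u, μ k u = 1) (hM0 : ∀ u v, M 0 u v = μ 0 v)
    (hidle : ∀ i : Fin K, ∀ u v, M i.succ u v = if v = u then 1 else 0) {ν : S → ℝ} (hν : ∀ (i : Fin K) (u : S), μ i.succ (φ i u) = ν u)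
    {c : ℕ} (hunif : ∀ i : Fin K, (univ.filter fun r : Fin m => κ r = i).card = c)
    {p : ℝ} (hp0 : 0 < p) (hp : ∀ u, p * ν u ≤ μ 0 u)
    {Wlo : ℝ} (hWlo0 : 0 < Wlo) (hWlo : ∀ u v, u ≠ v → Wlo ≤ max (ν u / μ 0 u) (ν v / μ 0 v))
    (hslow : 4 * t ≤ (1 - t) * w 0) (n : ℕ) :
    worstTvDist (fun y z : Fin (K + 1) → S =>
        t * ptGraphSwap μ (fun r : Fin m => ((0 : Fin (K + 1)), (κ r).succ)) (fun r => φ (κ r)) y z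
          + (1 - t) * prodKernel w M y z) (tensorFun μ) n
      ≤ (Real.exp 1 * (K * (1 / (p * Wlo))) + 1) * Real.exp (-((1 - t) * w 0 * (t / (t + (1 - t) * w 0) * (p / 3) / K) / 4) * n) := by
  -- the relabelled laws and kernels (`L_0 = id`, `L_{k+1} = φ_k⁻¹`)
  let L : Fin (K + 1) → Equiv.Perm S := Fin.cons (Equiv.refl S) (fun k => (φ k).symm)
  let μ' : Fin (K + 1) → S → ℝ := fun i u => μ i ((L i).symm u)
  let M' : Fin (K + 1) → S → S → ℝ := fun i u v => M i ((L i).symm u) ((L i).symm v)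
  have hL0 : L 0 = Equiv.refl S := starLevel_zero φ
  have hLs : ∀ k : Fin K, L k.succ = (φ k).symm := fun k => starLevel_succ φ k
  have h0 : ∀ u, μ' 0 u = μ 0 u := fun u => by show μ 0 ((L 0).symm u) = μ 0 u; rw [hL0]; rfl
  have hs : ∀ (i : Fin K) (u : S), μ' i.succ u = ν u := fun i u => by
    show μ i.succ ((L i.succ).symm u) = ν u; rw [hLs, Equiv.symm_symm, hν]
  have hμ' : ∀ k x, 0 < μ' k x := fun k x => hμ _ _
  have hμ1' : ∀ k, ∑ u, μ' k u = 1 := fun k => by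
    show ∑ u, μ k ((L k).symm u) = 1
    rw [Equiv.sum_comp (L k).symm (μ k)]; exact hμ1 k
  have hM0' : ∀ u v, M' 0 u v = μ' 0 v := fun u v => by
    show M 0 ((L 0).symm u) ((L 0).symm v) = μ 0 ((L 0).symm v); rw [hM0]
  have hidle' : ∀ (i : Fin K) (u v : S), M' i.succ u v = if v = u then 1 else 0 := fun i u v => by
    show M i.succ ((L i.succ).symm u) ((L i.succ).symm v) = if v = u then 1 else 0
    rw [hLs, Equiv.symm_symm, hidle]
    simp only [EmbeddingLike.apply_eq_iff_eq]
  -- `K ≥ 1` from the uniform list, so that `1 = (0 : Fin K).succ`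
  have hmK : (m : ℝ) = c * K := uniformList_card κ hunif
  have hK1 : 0 < K := by
    rcases Nat.eq_zero_or_pos K with hK0 | hK0
    · exfalso; rw [hK0] at hmK; simp at hmK; omega
    · exact hK0
  haveI : NeZero K := ⟨by omega⟩
  have h1 : (1 : Fin (K + 1)) = (0 : Fin K).succ := (Fin.succ_zero_eq_one' (n := K)).symm
  have hhom' : ∀ i : Fin K, μ' i.succ = μ' 1 := by
    intro i; funext u; rw [h1, hs, hs]
  have hp' : ∀ u, p * μ' 1 u ≤ μ' 0 u := by
    intro u; rw [h1, hs, h0]; exact hp u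
  have hWlo' : ∀ u v, u ≠ v → Wlo ≤ max (μ' 1 u / μ' 0 u) (μ' 1 v / μ' 0 v) := by
    intro u v huv; rw [h1, hs, hs, h0, h0]; exact hWlo u v huv
  -- the conjugacy: the flow scheme and its law are the relabelled identity-map scheme and law
  have hconj := flowHubList_apply_eq_conj κ φ (M := M) hμ t w
  have hP : (fun y z : Fin (K + 1) → S =>
        t * ptGraphSwap μ (fun r : Fin m => ((0 : Fin (K + 1)), (κ r).succ)) (fun r => φ (κ r)) y z
          + (1 - t) * prodKernel w M y z)
      = fun a b => (fun y z : Fin (K + 1) → S =>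
        t * ptGraphSwap μ' (fun r : Fin m => ((0 : Fin (K + 1)), (κ r).succ)) (fun _ : Fin m => Equiv.refl S) y z
          + (1 - t) * prodKernel w M' y z) (Equiv.piCongrRight L a) (Equiv.piCongrRight L b) := by
    funext a b
    rw [hconj a b, starRelabel_apply, starRelabel_apply]
  have hπ : tensorFun μ = fun a => tensorFun μ' (Equiv.piCongrRight L a) := by
    funext a
    rw [tensorFun_starRelabel φ μ a, starRelabel_apply]
  rw [hP, hπ, worstTvDist_relabel (Equiv.piCongrRight L)
    (fun y z : Fin (K + 1) → S =>
        t * ptGraphSwap μ' (fun r : Fin m => ((0 : Fin (K + 1)), (κ r).succ)) (fun _ : Fin m => Equiv.refl S) y z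
          + (1 - t) * prodKernel w M' y z) (tensorFun μ') n]
  exact homStar_worstTvDist_le_slowSwap κ (μ := μ') (M := M') hm ht0 ht1 hw0 hw00 hw1 hμ' hμ1' hM0' hidle' hhom' hunif hp0 hp' hWlo0 hWlo'
    hslow n

/-- **THE FLOW HUB'S MIXING TIME AT SLOW SWAPS:** same hypotheses, **`t_mix(ε) ≤ ⌈(4/((1−t)w_0·ρ))·log((e·(K·(1/(p·W_lo))) + 1)/ε)⌉₊`, `ρ = (t/(t+(1−t)w_0))(p/3)/K`** — i.e.
`⌈(12K(t+h)/(p·h·t))·log(…)⌉₊ ≤ ⌈(15K/(p·t))·log(…)⌉₊`, the conjectured order `K/(p·min{t,h})` for ANY flow, the configuration space entering only through `log(1/(p·W_lo))`. [ours] -/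
theorem flowStar_mixingTime_le_slowSwap [Nonempty S] (hm : 1 ≤ m) (ht0 : 0 < t) (ht1 : t < 1) (hw0 : ∀ k, 0 ≤ w k) (hw00 : 0 < w 0)
    (hw1 : ∑ k, w k = 1) (hμ : ∀ k x, 0 < μ k x) (hμ1 : ∀ k, ∑ u, μ k u = 1) (hM0 : ∀ u v, M 0 u v = μ 0 v)
    (hidle : ∀ i : Fin K, ∀ u v, M i.succ u v = if v = u then 1 else 0) {ν : S → ℝ} (hν : ∀ (i : Fin K) (u : S), μ i.succ (φ i u) = ν u)
    {c : ℕ} (hunif : ∀ i : Fin K, (univ.filter fun r : Fin m => κ r = i).card = c)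
    {p : ℝ} (hp0 : 0 < p) (hp : ∀ u, p * ν u ≤ μ 0 u)
    {Wlo : ℝ} (hWlo0 : 0 < Wlo) (hWlo : ∀ u v, u ≠ v → Wlo ≤ max (ν u / μ 0 u) (ν v / μ 0 v))
    (hslow : 4 * t ≤ (1 - t) * w 0) {ε : ℝ} (hε : 0 < ε) :
    mixingTime (fun y z : Fin (K + 1) → S =>
        t * ptGraphSwap μ (fun r : Fin m => ((0 : Fin (K + 1)), (κ r).succ)) (fun r => φ (κ r)) y z
          + (1 - t) * prodKernel w M y z) (tensorFun μ) ε
      ≤ ⌈1 / ((1 - t) * w 0 * (t / (t + (1 - t) * w 0) * (p / 3) / K) / 4) * Real.log ((Real.exp 1 * (K * (1 / (p * Wlo))) + 1) / ε)⌉₊ := by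
  have hh0 : 0 < (1 - t) * w 0 := mul_pos (by linarith) hw00
  have hmK : (m : ℝ) = c * K := uniformList_card κ hunif
  have hKpos : (0 : ℝ) < K := by
    rcases Nat.eq_zero_or_pos K with hK0 | hK0
    · exfalso; rw [hK0] at hmK; simp at hmK; omega
    · exact_mod_cast hK0
  set a := (1 - t) * w 0 * (t / (t + (1 - t) * w 0) * (p / 3) / K) / 4 with ha
  have ha0 : 0 < a := by positivity
  have hC : 0 < Real.exp 1 * (K * (1 / (p * Wlo))) + 1 := by positivity
  set n₀ : ℕ := ⌈1 / a * Real.log ((Real.exp 1 * (K * (1 / (p * Wlo))) + 1) / ε)⌉₊ with hn₀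
  refine mixingTime_le _ _ (t₀ := n₀) ?_
  exact (flowStar_worstTvDist_le_slowSwap κ φ hm ht0 ht1 hw0 hw00 hw1 hμ hμ1 hM0 hidle hν hunif hp0 hp hWlo0 hWlo hslow n₀).trans
    (exp_le_of_ge_log ha0 hC hε (Nat.le_ceil _))

end Flow

end Summit.Ventures.LatticeQCDFlow.Scaling

end
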